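import Summits.Parity.BatemanHorn.Theorems.SoloInformedSystemTiers
import Summits.Parity.BatemanHorn.Theorems.SoloInformedTwinPrimeLocalisation
import Literature.NumberTheory.Sieve.ParityWave0
import Literature.NumberTheory.Sieve.HardyLittlewoodTwinSieveProofs

/-!
# SoloInformedTwinPrimeTiers — the twin prime conjecture from any saving on one divisor sum

Solo unit `solo-Parity-informed` (ideation tier, informed mode), session 23; `PLAN.md` §31, CLAIMS C101.

The twin prime instance of `SoloInformedSystemTiers`, with no Bateman–Horn vocabulary left.  Fix
`0 < ε < 1` and put `T(x) := ∑_{n ≤ x} ∑_{e ∣ n(n+2), e > x^{1-ε}} μ(e) log² e`, `C₂` the twin prime constant.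
All three tiers of the twin prime problem are statements about the real sequence `T(x)/x`:

* **Tier 0 (theorems).**  `-(4C₂ + δ)·x ≤ T(x) ≤ (12C₂ + δ)·x` eventually, for every `δ > 0`
  (`eventually_neg_mul_le_twinTail`, from `Λ₂ ≥ 0`; `eventually_twinTail_le_mul`, from the proved sieve
  bound `π₂(x) ≤ (4 + o(1))·2C₂ x/log² x`, tree theorem `TwinSieveFour.twinSieveUpperBound_four`); in
  general a sieve constant `C` (`TwinSieveUpperBound C`) transfers to `T(x) ≤ (4(C-1)C₂ + δ)·x`
  (`eventually_twinTail_le_of_twinSieveUpperBound`).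
* **Tier 1 (the twin prime conjecture).**  If `T(x) ≥ -(4C₂ - c)·x` for some `c > 0` and infinitely many
  `x` — ANY constant improvement of the trivial lower bound along a sequence — then there are infinitely
  many twin primes (`twinPrimeConjecture_of_frequently_twinTail_ge`, concluding the tree's
  `TwinPrimeConjecture`); exactly: such a saving holds iff `π₂(x) ≥ c'·x/log² x` infinitely often for some
  `c' > 0` (`frequently_twinPrimeCount_ge_iff_twinTail_ge`).
* **Tier 2 (Hardy–Littlewood).**  `π₂(x) ~ 2C₂ x/log² x ⟺ T(x) = o(x)`
  (`twinPrime_isEquivalent_iff_tail_isLittleO`, `SoloInformedTwinPrimeLocalisation`).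

The value `-4C₂` of the trivial bound is minus the Hardy–Littlewood main term of `ψ₂(x) = ∑ Λ₂(n(n+2))`;
the ceiling `12C₂ = (4 - 1)·4C₂` is the factor `4` of the proved sieve bound, and the parity floor `C = 2` of
upper-bound sieves would be `T(x) ≤ (4C₂ + δ)·x`, the mirror image of the trivial lower bound: the parity
barrier, read on one explicit divisor sum.
-/

namespace Summit.Parity.BatemanHorn.Theorems

open Finset Filter ArithmeticFunction Asymptotics Polynomial
open scoped Topology Nat ArithmeticFunction.Moebius
open Literature.NumberTheory.Sieve (IsBatemanHornSystem batemanHornConst BatemanHornAsymptotic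
  twinSystem twinPrimeCount twinPrimeConst isBatemanHornSystem_twinSystem hasBatemanHornConst_twinSystem
  tendsto_twinPrimeConstPartial_holds twinPrimeConst_pos_holds TwinPrimeConjecture TwinSieveUpperBound)

/-! ### The dictionary twin system ↔ `n(n+2)` -/

/-- `|∏ᵢ fᵢ(n)| = n(n+2)` for the twin system `![X, X + 2]`. -/
theorem natAbs_eval_prod_twinSystem (n : ℕ) :
    ((∏ i, twinSystem i).eval (n : ℤ)).natAbs = n * (n + 2) := by
  have h : (∏ i, twinSystem i).eval (n : ℤ) = ((n * (n + 2) : ℕ) : ℤ) := by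
    simp only [twinSystem, Fin.prod_univ_two, Matrix.cons_val_zero, Matrix.cons_val_one,
      eval_mul, eval_X, eval_add, eval_ofNat]
    push_cast
    ring
  rw [h, Int.natAbs_natCast]

/-- "Every `|fᵢ(n)|` is prime" for the twin system means `n` and `n + 2` are prime. -/
theorem allPrime_twinSystem_iff (n : ℕ) :
    (∀ i, Nat.Prime ((twinSystem i).eval (n : ℤ)).natAbs) ↔ n.Prime ∧ (n + 2).Prime := by
  have h2 : ((n : ℤ) + 2).natAbs = n + 2 := by
    rw [show ((n : ℤ) + 2) = ((n + 2 : ℕ) : ℤ) by push_cast; ring, Int.natAbs_natCast]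
  simp only [Fin.forall_fin_two, twinSystem, Matrix.cons_val_zero, Matrix.cons_val_one, eval_X,
    eval_add, eval_ofNat, Int.natAbs_natCast, h2]

/-- `C(![X, X + 2]) = 2C₂`. -/
theorem batemanHornConst_twinSystem : batemanHornConst twinSystem = 2 * twinPrimeConst :=
  (hasBatemanHornConst_twinSystem tendsto_twinPrimeConstPartial_holds).batemanHornConst_eq

/-- `k!·C(f) = 4C₂` for the twin system. -/
theorem factorial_mul_batemanHornConst_twinSystem :
    ((Fintype.card (Fin 2))! : ℝ) * batemanHornConst twinSystem = 4 * twinPrimeConst := by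
  rw [Fintype.card_fin, batemanHornConst_twinSystem, Nat.factorial_two]
  push_cast
  ring

/-- The signed large-divisor tail of the twin system is `T(x) = ∑_{n ≤ x} ∑_{e ∣ n(n+2), e > y} μ(e) log² e`. -/
theorem signedTail_twinSystem (x y : ℕ) :
    (-1 : ℝ) ^ Fintype.card (Fin 2) * ∑ n ∈ Icc 1 x,
        ∑ e ∈ (((∏ i, twinSystem i).eval (n : ℤ)).natAbs).divisors with y < e,
          (μ e : ℝ) * Real.log e ^ Fintype.card (Fin 2) =
      ∑ n ∈ Icc 1 x, ∑ e ∈ (n * (n + 2)).divisors with y < e, (μ e : ℝ) * Real.log e ^ 2 := by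
  simp_rw [natAbs_eval_prod_twinSystem, Fintype.card_fin]
  norm_num

/-- `π₂(x) = #{1 ≤ n ≤ x : n, n + 2 prime}` (the `n = 0` of `range (x+1)` is not prime). -/
theorem twinPrimeCount_eq_card_filter (x : ℕ) :
    twinPrimeCount x =
      #((Icc 1 x).filter fun n : ℕ => ∀ i, Nat.Prime ((twinSystem i).eval (n : ℤ)).natAbs) := by
  unfold twinPrimeCount
  congr 1
  ext n
  simp only [mem_filter, mem_range, mem_Icc, allPrime_twinSystem_iff]
  constructor
  · rintro ⟨hn, hp, hp2⟩
    exact ⟨⟨hp.one_lt.le, by omega⟩, hp, hp2⟩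
  · rintro ⟨⟨h1, hx⟩, hp, hp2⟩
    exact ⟨by omega, hp, hp2⟩

/-! ### Tier 0: `-(4C₂ + δ) x ≤ T(x) ≤ (12C₂ + δ) x` -/

/-- **Tier 0, lower (unconditional):** `T(x) ≥ -(4C₂ + δ)·x` eventually, every `δ > 0`. -/
theorem eventually_neg_mul_le_twinTail {ε : ℝ} (hε : 0 < ε) (hε1 : ε < 1) {δ : ℝ} (hδ : 0 < δ) :
    ∀ᶠ x : ℕ in atTop, -(4 * twinPrimeConst + δ) * (x : ℝ) ≤
      ∑ n ∈ Icc 1 x, ∑ e ∈ (n * (n + 2)).divisors with ⌊(x : ℝ) ^ (1 - ε)⌋₊ < e,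
        (μ e : ℝ) * Real.log e ^ 2 := by
  filter_upwards [eventually_neg_mul_le_signedTail isBatemanHornSystem_twinSystem (by simp) hε hε1 hδ]
    with x hx
  rwa [signedTail_twinSystem, factorial_mul_batemanHornConst_twinSystem] at hx

/-- **Tier 0, upper — every sieve constant transfers:** `TwinSieveUpperBound C`
(`π₂(x) ≤ (C + o(1))·2C₂·x/log² x`) gives `T(x) ≤ (4(C-1)C₂ + δ)·x` eventually, every `δ > 0`.  (The
parity floor `C = 2` of upper-bound sieves would give `T(x) ≤ (4C₂ + δ)·x`, the mirror image of the trivial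
lower bound; Hardy–Littlewood, `C = 1`, is `T(x) = o(x)`.) -/
theorem eventually_twinTail_le_of_twinSieveUpperBound {C : ℝ} (hC0 : 0 < C)
    (hCs : TwinSieveUpperBound C) {ε : ℝ} (hε : 0 < ε) (hε1 : ε < 1) {δ : ℝ} (hδ : 0 < δ) :
    ∀ᶠ x : ℕ in atTop,
      ∑ n ∈ Icc 1 x, ∑ e ∈ (n * (n + 2)).divisors with ⌊(x : ℝ) ^ (1 - ε)⌋₊ < e,
          (μ e : ℝ) * Real.log e ^ 2 ≤ (4 * (C - 1) * twinPrimeConst + δ) * (x : ℝ) := by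
  have hC : 0 < twinPrimeConst := twinPrimeConst_pos_holds
  have hdeg : ((X : ℤ[X]) + 2).natDegree = 1 := by simpa using natDegree_X_add_C (2 : ℤ)
  -- the weights `log n · log (n+2) ~ 1 · log² n`
  have hw : (fun n : ℕ => ∏ i, Real.log ((((twinSystem i).eval (n : ℤ)).natAbs : ℕ) : ℝ)) ~[atTop]
      fun n : ℕ => (1 : ℝ) * Real.log n ^ 2 := by
    convert isEquivalent_prod_log_natAbs_eval isBatemanHornSystem_twinSystem.natDegree_pos using 2
      with n
    simp [Fin.prod_univ_two, twinSystem, hdeg]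
  have hw0 : ∀ n : ℕ, 0 ≤ ∏ i, Real.log ((((twinSystem i).eval (n : ℤ)).natAbs : ℕ) : ℝ) :=
    fun n => prod_nonneg fun i _ => Real.log_natCast_nonneg _
  -- the count bound in the shape `P(x) ≤ (1 + c) (2 C C₂/1) x / log² x`
  have hP : ∀ c : ℝ, 0 < c → ∀ᶠ x : ℕ in atTop,
      (#((Icc 1 x).filter fun n : ℕ => ∀ i, Nat.Prime ((twinSystem i).eval (n : ℤ)).natAbs) : ℝ) ≤
        (1 + c) * (2 * C * twinPrimeConst / 1 * x / Real.log x ^ 2) := by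
    intro c hc
    filter_upwards [hCs (c * C) (by positivity)] with x hx
    rw [← twinPrimeCount_eq_card_filter]
    convert hx using 1
    ring
  have hθ := eventually_weightedSum_le_of_card_le_pow
    (p := fun n : ℕ => ∀ i, Nat.Prime ((twinSystem i).eval (n : ℤ)).natAbs)
    two_ne_zero one_pos (by positivity : 0 < 2 * C * twinPrimeConst) hw0 hw hP
  have h := eventually_signedTail_le_of_theta_le isBatemanHornSystem_twinSystem (by simp) hε hε1
    (K := 2 * C * twinPrimeConst) (by positivity) hθ hδ
  filter_upwards [h] with x hx
  rw [signedTail_twinSystem, factorial_mul_batemanHornConst_twinSystem, Fintype.card_fin,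
    Nat.factorial_two] at hx
  convert hx using 2
  push_cast
  ring

/-- **Tier 0, upper (unconditional):** `T(x) ≤ (12C₂ + δ)·x` eventually, every `δ > 0` — the proved
sieve constant `C = 4` (the linear sieve on `{p + 2}` at the Bombieri–Vinogradov level, tree theorem
`TwinSieveFour.twinSieveUpperBound_four`) read on the divisor sum. -/
theorem eventually_twinTail_le_mul {ε : ℝ} (hε : 0 < ε) (hε1 : ε < 1) {δ : ℝ} (hδ : 0 < δ) :
    ∀ᶠ x : ℕ in atTop,
      ∑ n ∈ Icc 1 x, ∑ e ∈ (n * (n + 2)).divisors with ⌊(x : ℝ) ^ (1 - ε)⌋₊ < e,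
          (μ e : ℝ) * Real.log e ^ 2 ≤ (12 * twinPrimeConst + δ) * (x : ℝ) := by
  filter_upwards [eventually_twinTail_le_of_twinSieveUpperBound four_pos
    Literature.NumberTheory.Sieve.TwinSieveFour.twinSieveUpperBound_four hε hε1 hδ] with x hx
  have h12 : (4 * (4 - 1) * twinPrimeConst + δ) * (x : ℝ) = (12 * twinPrimeConst + δ) * x := by ring
  rwa [h12] at hx

/-! ### Tier 1: the twin prime conjecture -/

/-- **The twin prime conjecture from any saving on the large divisors.**  If for some `c > 0` and
infinitely many `x`, `∑_{n ≤ x} ∑_{e ∣ n(n+2), e > x^{1-ε}} μ(e) log² e ≥ -(4C₂ - c)·x`, then there are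
infinitely many twin primes. -/
theorem twinPrimeConjecture_of_frequently_twinTail_ge {ε : ℝ} (hε : 0 < ε) (hε1 : ε < 1)
    (h : ∃ c : ℝ, 0 < c ∧ ∃ᶠ x : ℕ in atTop, (c - 4 * twinPrimeConst) * (x : ℝ) ≤
      ∑ n ∈ Icc 1 x, ∑ e ∈ (n * (n + 2)).divisors with ⌊(x : ℝ) ^ (1 - ε)⌋₊ < e,
        (μ e : ℝ) * Real.log e ^ 2) :
    TwinPrimeConjecture := by
  have hinf := infinite_setOf_allPrime_of_frequently_signedTail_ge isBatemanHornSystem_twinSystem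
    (by simp) hε hε1 (f := twinSystem) ?_
  · intro n
    obtain ⟨p, hp, hnp⟩ := hinf.exists_gt n
    rw [Set.mem_setOf_eq, allPrime_twinSystem_iff] at hp
    exact ⟨p, hnp, hp.1, hp.2⟩
  · obtain ⟨c, hc, hfr⟩ := h
    refine ⟨c, hc, hfr.mono fun x hx => ?_⟩
    rwa [signedTail_twinSystem, factorial_mul_batemanHornConst_twinSystem]

/-- **Tier 1 exactly.**  `∃ c > 0: π₂(x) ≥ c·x/log² x` for infinitely many `x`
`⟺ ∃ c > 0: ∑_{n ≤ x} ∑_{e ∣ n(n+2), e > x^{1-ε}} μ(e) log² e ≥ (c - 4C₂)·x` for infinitely many `x`. -/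
theorem frequently_twinPrimeCount_ge_iff_twinTail_ge {ε : ℝ} (hε : 0 < ε) (hε1 : ε < 1) :
    (∃ c : ℝ, 0 < c ∧ ∃ᶠ x : ℕ in atTop, c * (x : ℝ) / Real.log x ^ 2 ≤ (twinPrimeCount x : ℝ)) ↔
      (∃ c : ℝ, 0 < c ∧ ∃ᶠ x : ℕ in atTop, (c - 4 * twinPrimeConst) * (x : ℝ) ≤
        ∑ n ∈ Icc 1 x, ∑ e ∈ (n * (n + 2)).divisors with ⌊(x : ℝ) ^ (1 - ε)⌋₊ < e,
          (μ e : ℝ) * Real.log e ^ 2) := by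
  have h1 := frequently_signedTail_ge_iff_theta_ge isBatemanHornSystem_twinSystem (by simp) hε hε1
  rw [frequently_theta_ge_iff_card_ge isBatemanHornSystem_twinSystem (by simp)] at h1
  simp only [signedTail_twinSystem, factorial_mul_batemanHornConst_twinSystem] at h1
  simp only [Fintype.card_fin, ← twinPrimeCount_eq_card_filter] at h1
  exact h1.symm

/-- **Tier 2 ⟹ Tier 1 for twins:** the Hardy–Littlewood asymptotic gives the saving with `c = 2C₂`. -/
theorem frequently_twinTail_ge_of_hardyLittlewood {ε : ℝ} (hε : 0 < ε) (hε1 : ε < 1)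
    (h : (fun x : ℕ => (twinPrimeCount x : ℝ)) ~[atTop]
      fun x : ℕ => 2 * twinPrimeConst * x / Real.log x ^ 2) :
    ∃ c : ℝ, 0 < c ∧ ∃ᶠ x : ℕ in atTop, (c - 4 * twinPrimeConst) * (x : ℝ) ≤
      ∑ n ∈ Icc 1 x, ∑ e ∈ (n * (n + 2)).divisors with ⌊(x : ℝ) ^ (1 - ε)⌋₊ < e,
        (μ e : ℝ) * Real.log e ^ 2 := by
  have hBH := batemanHornAsymptotic_twinSystem_iff.mpr h
  obtain ⟨c, hc, hfr⟩ := frequently_signedTail_ge_of_batemanHornAsymptotic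
    isBatemanHornSystem_twinSystem hε hε1 hBH
  refine ⟨c, hc, hfr.mono fun x hx => ?_⟩
  rwa [signedTail_twinSystem, factorial_mul_batemanHornConst_twinSystem] at hx

end Summit.Parity.BatemanHorn.Theorems
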